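import Literature.IUT.HodgeTheaters.ThetaPMEllNFHodgeTheatersIso
import Literature.IUT.HodgeTheaters.PMBaseProcessionsProofs

/-!
# [IUTchI] §6, Definition 6.13 (i): consistency of Θ^{±ell}NF-Hodge theaters relative to the kits

Mochizuki, *Inter-universal Teichmüller theory I*, §6, Remark 6.12.2 (i), (ii) pp. 174–175 and
Definition 6.13 (i) p. 182, kurims manuscript (May 2020) ([IUTchI] Def 6.13 (i) p.182) [claim: Mochizuki2012, status: disputed].
CONSISTENCY companion to `ThetaPMEllHodgeTheaters.lean` (abc-iut-L5-t4: `S5Local.ThetaGluing`,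
`S5Local.ThetaPMEllNFHT` = Def 6.13 (i)) and `ThetaPMEllNFHodgeTheatersIso.lean` (abc-iut-L5-t5:
`S5Local.IsoKit`): the consistency inhabitant `S5Local.toy` of the ΘNF-side kit (`ThetaNFKit.lean`)
has an EMPTY index set `J`, so — a gluing identifying `J` with `T^⋇`, which has `l^⋇ ≥ 1` elements —
no Θ^{±ell}NF-Hodge theater exists over it; this file records a second inhabitant of the ΘNF-side kit over
the same toy kits (`S5Local.toyTheta`: one ΘNF-Hodge theater with `J := {1, …, l^⋇}`, constituents the
model `ℱ`-prime-strip, `𝒟-Θ`-bridge poly-morphisms the full poly-isomorphisms — the shape of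
Proposition 6.7's output at `v ∈ 𝕍^good`, and the toy kit has `𝕍^bad = ∅`), an `ℱ`-level Θ^{±ell}-Hodge
theater over the toy `ℱ`-kit (the model of Examples 6.2 (i) / 6.3 (i), whose associated `𝒟`-data are
those of `Ex62.ht`: over `FKit.toy` the base functor is the identity), the gluing of Remark 6.12.2 (i)
between them, and hence an inhabitant `S5Local.ThetaPMEllNFHT.toy` of the type of [IUTchI] Def 6.13 (i)
— together with an isomorphism kit `S5Local.IsoKit.toyTheta` over the new toy. KIT-RULE evidence only
(the types typed from print are not vacuous over the kits); nothing of the series is asserted.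
-/

namespace Literature.IUT.HodgeTheaters

open CategoryTheory

namespace PMBaseKit

/-! ### `T^⋇` is finite of cardinality `l^⋇` -/

namespace DThetaPMBridge

variable {l : ℕ} {K : PMBaseKit l} (B : K.DThetaPMBridge)

/-- For `l` odd, `T^⋇` (of cardinality `l^⋇ = (l − 1)/2 ≥ 1`, `card_absStar`) is a finite type.
([IUTchI] Def 6.4 (i) p.162) [claim: Mochizuki2012, status: disputed] -/
theorem absStar_finite (hlo : Odd l) (h3 : 3 ≤ l) : Finite B.grpT.AbsStar :=
  Nat.finite_of_card_ne_zero (by rw [B.card_absStar hlo]; unfold lStar; omega)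

/-- For `l` odd `≥ 3`, an enumeration `{1, …, l^⋇} ⥲ T^⋇` (any bijection; `card_absStar`) — used as the
index identification `J ⥲ T^⋇` of a toy gluing ([IUTchI] Rmk 6.12.2 (i) p. 174 "[so `J = T^⋇`]").
([IUTchI] Rmk 6.12.2 (i) p.174) [claim: Mochizuki2012, status: disputed] -/
noncomputable def finEquivAbsStar (hlo : Odd l) (h3 : 3 ≤ l) : Fin ((l - 1) / 2) ≃ B.grpT.AbsStar :=
  haveI := B.absStar_finite hlo h3
  ((Finite.equivFin B.grpT.AbsStar).trans (finCongr (B.card_absStar hlo))).symm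

end DThetaPMBridge

/-- An odd prime is at least `3`. [folklore] -/
private theorem three_le_of_prime_ne_two {l : ℕ} (hp : l.Prime) (h2 : l ≠ 2) : 3 ≤ l := by
  have := hp.two_le; omega

variable (l : ℕ) [Fact l.Prime] (hl : l ≠ 2)

/-! ### The toy `ℱ`-prime-strip and a ΘNF-side kit with nonempty index set -/

/-- The model `ℱ`-prime-strip over the toy `ℱ`-kit: every constituent the model object (so its associated
`𝒟`-prime-strip is the tautological `𝒟`-prime-strip of the toy base kit, [IUTchI] Ex 6.2 (i) p. 160).
([IUTchI] Def 5.2 (i) p.134) [claim: Mochizuki2012, status: disputed] -/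
noncomputable def FKit.FStrip.toyLoc : (FKit.toy l hl).FStrip := ⟨fun _ => Model.Obj.loc, fun _ => ⟨Iso.refl _⟩⟩

/-- A second model of the ΘNF-side kit `S5Local` over the toy kits (cf. `S5Local.toy`, whose index set
is empty): ONE ΘNF-Hodge theater whose Θ-bridge has index set `J := {1, …, l^⋇}` (as `Fin l^⋇`),
capsule and `‡𝔉_>` the model `ℱ`-prime-strip, and `𝒟-Θ`-bridge poly-morphisms the full poly-isomorphisms
("`φ^Θ_{v_j}` … the full poly-isomorphism" at `v ∈ 𝕍^good`, [IUTchI] Example 4.4 (iii) p. 107; the toy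
base kit has `𝕍^bad = ∅`); "forms a `𝒟-ΘNF`-Hodge theater" trivially true.
([IUTchI] Def 5.5 (iii) p.153) [claim: Mochizuki2012, status: disputed] -/
noncomputable def S5Local.toyTheta : (toyKit l hl).S5Local (MultKit.toy l hl) (FKit.toy l hl) where
  CatAmb := SingleObj (Model.AGL l)
  nfAtV _ := Model.atV' l
  IsDThetaNFHT _ _ _ := True
  ThetaNFHT := PUnit
  thJ _ := Fin ((l - 1) / 2)
  thCapsule _ _ := FKit.FStrip.toyLoc l hl
  thFgt _ := FKit.FStrip.toyLoc l hl
  thDPoly _ _ v :=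
    {h | ∃ f : ((FKit.FStrip.toyLoc l hl).assocD).obj v ≅ ((FKit.FStrip.toyLoc l hl).assocD).obj v, h = f.hom}

/-! ### An `ℱ`-level Θ^{±ell}-Hodge theater over the toy kits -/

/-- The model Θ^{±ell}-Hodge theater over the toy `ℱ`-kit: index set `𝔽_l` with its tautological
`𝔽_l^±`-group structure, all `ℱ`-prime-strips the model one, and — on the associated `𝒟`-data, which ARE
the model data of Examples 6.2 (i) / 6.3 (i) since the toy base functor is the identity — the
`𝒟-Θ^±`- and `𝒟-Θ^{ell}`-bridge poly-morphisms `φ^{Θ±}_t`, `φ^{Θell}_{v_t}` of `Ex62.ht` ([IUTchI] Def 6.11 (iii)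
p. 173; Def 6.4 (iii), Fig. 6.1). ([IUTchI] Def 6.11 (iii) p.173) [claim: Mochizuki2012, status: disputed] -/
noncomputable def FKit.ThetaPMEllHT.toy : (FKit.toy l hl).ThetaPMEllHT :=
  haveI : NeZero l := ⟨(Fact.out : l.Prime).ne_zero⟩
  { T := ZMod l
    grpT := FlPMGroup.tautological l
    capsule := fun _ => FKit.FStrip.toyLoc l hl
    codomain := FKit.FStrip.toyLoc l hl
    glob := (toyKit l hl).gModel
    dPolyPM := Ex62.poly (toyKit l hl)
    dPolyEll := Ex63.poly (toyKit l hl)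
    exists_model := (Ex62.ht (toyKit l hl)).exists_model }

/-! ### The gluing of Remark 6.12.2 (i) over the toy kits -/

/-- **The gluing of Rmk 6.12.2 (i) over the toy kits**: the toy ΘNF-Hodge theater's Θ-bridge IS glued to
the Θ^±-bridge of the toy Θ^{±ell}-Hodge theater via Proposition 6.7 — along any enumeration
`{1, …, l^⋇} ⥲ T^⋇`, the compatibility of the full poly-isomorphisms with the two `𝒟-Θ`-bridges holding
because all `𝒟-Θ`-bridge poly-morphisms in play are full (`𝕍^bad = ∅` in the toy kit) ([IUTchI] Rmk
6.12.2 (i) p. 174). ([IUTchI] Rmk 6.12.2 (i) p.174) [claim: Mochizuki2012, status: disputed] -/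
noncomputable def S5Local.ThetaGluing.toy (hlo : Odd l) :
    (S5Local.toyTheta l hl).ThetaGluing (FKit.ThetaPMEllHT.toy l hl).pmBridge PUnit.unit hlo where
  indexEquiv := (FKit.ThetaPMEllHT.toy l hl).pmBridge.dBridge.finEquivAbsStar hlo
    (three_le_of_prime_ne_two Fact.out hl)
  compat j v := by
    have hv : v ∉ (toyKit l hl).bad := Finset.notMem_empty v
    ext h
    simp only [DThetaPMBridge.thetaBridgeData, dif_neg hv, S5Local.toyTheta]
    constructor
    · rintro ⟨φ, g, ⟨f, rfl⟩, rfl⟩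
      exact ⟨(φ ≪≫ f).hom, Iso.refl _, ⟨φ ≪≫ f, rfl⟩, (Category.comp_id _).symm⟩
    · rintro ⟨f, ψ, ⟨g, rfl⟩, rfl⟩
      exact ⟨Iso.refl _, (g ≪≫ ψ).hom, ⟨g ≪≫ ψ, rfl⟩, (Category.id_comp _).symm⟩

/-- **Def 6.13 (i) is consistent relative to the kits**: a Θ^{±ell}NF-Hodge theater over the toy kits —
(a) the toy Θ^{±ell}-Hodge theater, (b) the toy ΘNF-Hodge theater, (c) the toy gluing ([IUTchI] Def 6.13
(i) p. 182 "a triple … (a) … (b) … (c) the [necessarily unique!] gluing isomorphism"). KIT-RULE evidence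
that the typed notion is inhabited; no claim that this inhabitant is print's object.
([IUTchI] Def 6.13 (i) p.182) [claim: Mochizuki2012, status: disputed] -/
noncomputable def S5Local.ThetaPMEllNFHT.toy (hlo : Odd l) : (S5Local.toyTheta l hl).ThetaPMEllNFHT hlo :=
  ⟨FKit.ThetaPMEllHT.toy l hl, PUnit.unit, S5Local.ThetaGluing.toy l hl hlo⟩

/-- An isomorphism kit (abc-iut-L5-t5's `S5Local.IsoKit`, [IUTchI] Def 5.5 (iii) / Cor 5.6 (ii)) over the
second toy: one global object, empty NF-data, trivial ΘNF-side isomorphism types, and "bijections of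
index sets" as isomorphisms of `𝒟-ΘNF`-Hodge theaters — so the isomorphism notions of Rmk 6.12.2 (ii)
are available on the inhabitant `S5Local.ThetaPMEllNFHT.toy`.
([IUTchI] Def 5.5 (iii) p.153) [claim: Mochizuki2012, status: disputed] -/
noncomputable def S5Local.IsoKit.toyTheta : (S5Local.toyTheta l hl).IsoKit where
  thGlob _ := SingleObj.star (Model.AGL l)
  thNFPoly _ _ _ := ∅
  th_isHT _ := trivial
  thIso _ _ := PUnit
  thIsoIndex _ := Equiv.refl _
  dIso X₁ X₂ := X₁.thBridge.J ≃ X₂.thBridge.J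
  dIsoIndex e := e
  thIsoToD _ := Equiv.refl _
  thIsoToD_index _ _ := rfl

end PMBaseKit

end Literature.IUT.HodgeTheaters
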